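import Literature.AlgebraicGeometry.HodgeTheory.MonomialSupportedHypersurfaceInvariantCycles
import Literature.AlgebraicGeometry.HodgeTheory.MonomialLinearSystemIncidenceCohomology
import Literature.AlgebraicGeometry.Motives.MonomialLinearSystemIncidenceFamily
import HarnessLib

/-!
# Odd-degree monodromy of a base-point-free monomial linear system has no invariants

Family `hodge`, layer `Literature/AlgebraicGeometry/HodgeTheory`; theorems only (no definition, no named
fact). For a base-point-free set `M` of degree-`d` monomials in `x₀, …, x_{n+1}` (`n, d ≥ 1`;
base-point free: `xᵢᵈ ∈ M` for all `i`, `IsBasePointFree`) let `π_M : 𝒴_M → S_M` be the family of smooth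
`M`-supported hypersurfaces (`Motives/MonomialSupportedHypersurfaceFamily`) and
`Γ_t ⊆ GL(Hᵏ(Y_t; ℚ))` its rational monodromy group at `t ∈ S_M(ℂ)`.

**Theorem** (`familyM_ratInvariant_eq_zero_of_odd`). Assume Deligne's global invariant cycle theorem
(the tree's named fact `deligne_globalInvariantCycles`, Hodge II Thm. 4.1.1). Then for odd `k` every
`Γ_t`-invariant class of `Hᵏ(Y_t; ℚ)` is zero.

This is Voisin II, Thm. 4.24 / Cor. 4.25 ("the space of invariants is the image of `Hᵏ(X, ℚ)` for
any smooth projective `X ⊇ X_U`") for the compactification `X̄ ⊇ W_M ⊇ 𝒴_M` of the incidence variety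
`W_M = {(f, x) | f(x) = 0} ⊆ 𝔸^M × ℙⁿ⁺¹`, whose odd cohomology vanishes: assembled from
`familyM_ratInvariant_eq_zero_of_factor` (`MonomialSupportedHypersurfaceInvariantCycles`: GIC +
Hironaka + rational transport), the open immersion `𝒴_M ↪ W_M` (`totalMToIncidence`,
`Motives/MonomialLinearSystemIncidenceFamily`), smoothness / quasi-projectivity / irreducibility of
`W_M` (`Motives/MonomialLinearSystemIncidence`) and `H^{odd}(W_M(ℂ); ℂ) = 0`
(`subsingleton_complexBetti_incidenceOverM_of_odd`, `MonomialLinearSystemIncidenceCohomology`).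
The case `n = 3`, `M = {ι-even monomials}` is the input `stub_signNoInvariants` of crux K1-B of the
route SignSymmetricPowers (Hodge conjecture cell). The parity-free form
(`familyM_ofRatClass_ratInvariant_mem_range_projectiveSpace`): for every `k` the invariants come from
`Hᵏ(ℙⁿ⁺¹(ℂ); ℂ)` (`q^*` is bijective, `bijective_complexBetti_map_incidenceToProj`).

## References

* C. Voisin, *Hodge Theory and Complex Algebraic Geometry II* (2003), Thm. 4.24, Cor. 4.25, §6.2.1. [VoisinHodgeII2003]
* P. Deligne, *Théorie de Hodge II*, Publ. Math. IHÉS 40 (1971), Thm. 4.1.1. [DeligneHodgeII1971]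
-/

noncomputable section

open CategoryTheory AlgebraicGeometry
open Literature.AlgebraicTopology.SingularHomology
open Literature.AlgebraicGeometry.Motives
open Literature.AlgebraicGeometry.Motives.UniversalHypersurface

namespace Literature.AlgebraicGeometry.HodgeTheory.UniversalHypersurface

/-- **Parity systems are base-point free**: for `d` even, the degree-`d` monomials `x^m` in
`x₀, …, x_{n+1}` with `m₀ + m₁` even (equivalently: invariant under the sign involution
`ι : x₀ ↦ -x₀, x₁ ↦ -x₁`) contain every `xᵢᵈ`. [cite: VoisinHodgeII2003, §6.2.1] -/
theorem isBasePointFree_setOf_even_add {n d : ℕ} (hd : Even d) :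
    IsBasePointFree n d {m : DegIndex n d | Even (m.1 0 + m.1 1)} := by
  intro i
  simp only [Set.mem_setOf_eq, Finsupp.single_apply]
  split_ifs <;> simp [hd]

/-- **Odd-degree monodromy invariants of a base-point-free monomial linear system vanish** (assuming
`deligne_globalInvariantCycles`): for `M` base-point free, `n, d ≥ 1`, `k` odd, `t ∈ S_M(ℂ)` and
`x ∈ Hᵏ(Y_t; ℚ)` with `g x = x` for all `g ∈ Γ_t = ratMonodromyGroup π_M k _ t`, one has `x = 0`
(Voisin II Thm. 4.24 / Cor. 4.25 applied with `X ⊇ W_M ⊇ 𝒴_M`, `H^{odd}(W_M) = 0`).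
[cite: VoisinHodgeII2003, Thm. 4.24 and Cor. 4.25] [cite: DeligneHodgeII1971, Théorème 4.1.1] -/
theorem familyM_ratInvariant_eq_zero_of_odd (hGIC : deligne_globalInvariantCycles)
    {n d : ℕ} {M : Set (DegIndex n d)} (hM : IsBasePointFree n d M) (hn : 1 ≤ n) (hd : 1 ≤ d)
    {k : ℕ} (hk : Odd k)
    (hU : IsCohomologicallyLocallyTrivialOn (familyM ℂ n d M) Set.univ)
    (t : ComplexPoints (baseM ℂ n d M))
    (x : bettiCohomology (fiberOver (familyM ℂ n d M) t) k)
    (hx : ∀ g ∈ ratMonodromyGroup (familyM ℂ n d M) k hU ⟨t, Set.mem_univ t⟩, g x = x) :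
    x = 0 :=
  familyM_ratInvariant_eq_zero_of_factor n d M hGIC hn hd k hU
    (smoothOfRelativeDimension_incidenceOverM_hom ℂ n d M hM hd)
    (isQuasiProjectiveOver_incidenceOverM ℂ n d M) (irreducibleSpace_incidenceM ℂ n d M hM hd)
    (totalMToIncidence ℂ n d M hd) (isOpenImmersion_totalMToIncidence_left ℂ n d M hd)
    (fun _ β => by
      haveI := subsingleton_complexBetti_incidenceOverM_of_odd n d M hM hd hk
      rw [Subsingleton.elim β 0, map_zero])
    t x hx

/-! ### The parity-free form: invariants come from `ℙⁿ⁺¹` -/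

/-- **Monodromy invariants of `π_M` come from any `W` through which `𝒴_M` openly embeds** (the
range form of `familyM_ratInvariant_eq_zero_of_factor`, no vanishing hypothesis): assuming
`deligne_globalInvariantCycles`, for an open immersion `j : 𝒴_M ⟶ W` over `ℂ` into a smooth,
quasi-projective, irreducible `W`, the complexification of every `Γ_t`-invariant class of `Hᵏ(Y_t; ℚ)`
lies in the image of `(Y_t ↪ 𝒴_M ↪ W)^* : Hᵏ(W(ℂ); ℂ) → Hᵏ(Y_t(ℂ); ℂ)` (compactify `W ⊆ X̄` by
Hironaka and apply the global invariant cycle theorem to `𝒴_M ↪ X̄`).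
[cite: VoisinHodgeII2003, Thm. 4.24] [cite: DeligneHodgeII1971, Théorème 4.1.1] -/
theorem familyM_ofRatClass_mem_range_of_factor (hGIC : deligne_globalInvariantCycles)
    {n d : ℕ} {M : Set (DegIndex n d)} (hn : 1 ≤ n) (hd : 1 ≤ d) (k : ℕ)
    (hU : IsCohomologicallyLocallyTrivialOn (familyM ℂ n d M) Set.univ)
    {W : SchemeOver ℂ} {m : ℕ} (hW : SmoothOfRelativeDimension m W.hom)
    (hWq : IsQuasiProjectiveOver W) (hWirr : IrreducibleSpace W.left)
    (j : totalM ℂ n d M ⟶ W) (hj : IsOpenImmersion j.left)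
    (t : ComplexPoints (baseM ℂ n d M))
    (x : bettiCohomology (fiberOver (familyM ℂ n d M) t) k)
    (hx : ∀ g ∈ ratMonodromyGroup (familyM ℂ n d M) k hU ⟨t, Set.mem_univ t⟩, g x = x) :
    ∃ β : complexBetti W k, ofRatClass _ k x = complexBetti.map (fiberι (familyM ℂ n d M) t ≫ j) k β := by
  obtain ⟨Xbar, iW, hXbar, hiW⟩ := Hironaka1964_smoothCompactification_holds m W hW hWq hWirr
  haveI := hj
  haveI := hiW
  have hi : IsOpenImmersion (j ≫ iW).left := by
    rw [Over.comp_left]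
    infer_instance
  haveI := pathConnectedSpace_complexPoints_baseM n d M t
  haveI := locallyPathConnectedSpace_complexPoints_baseM n d M
  obtain ⟨A, hA⟩ := hGIC.of_forall_transportFun_eq (familyM ℂ n d M) (j ≫ iW)
    (isSmoothProjectiveFamily_familyM ℂ n d M hn hd) (isQuasiProjectiveOver_baseM n d M)
    (smooth_baseM_hom ℂ n d M) hXbar.isProjectiveOver hXbar.smoothOfRelativeDimension hi hU k t
    (ofRatClass _ k x)
    (transportFun_ofRatClass_eq_of_forall_mem_ratMonodromyGroup n d M hn hd k hU t x hx)
  refine ⟨complexBetti.map iW k A, ?_⟩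
  rw [hA, ← Category.assoc, complexBetti.map_comp, ModuleCat.comp_apply]

/-- **`q^* : Hᵏ(ℙⁿ⁺¹(ℂ); ℂ) → Hᵏ(W_M(ℂ); ℂ)` is bijective** for the incidence variety of a base-point-free
system (`d ≥ 1`): `W_M → ℙⁿ⁺¹` is Zariski-locally the product with `𝔸^{|M|-1}` (the polynomial charts of
`MonomialLinearSystemIncidenceCohomology`), Dold 1963 Thm. 6.3. [cite: Dold1963, Thm. 6.3] -/
theorem bijective_complexBetti_map_incidenceToProj (n d : ℕ) (M : Set (DegIndex n d))
    (hM : IsBasePointFree n d M) (hd : 0 < d) (k : ℕ) :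
    Function.Bijective (complexBetti.map (incidenceToProj ℂ n d M) k) := by
  haveI : T2Space (ComplexPoints (projectiveSpace (n + 1) ℂ)) :=
    ComplexPoints.t2Space_of_isSmoothProjective (isSmoothProjective_projectiveSpace_holds ℂ (n + 1))
  haveI : CompactSpace (ComplexPoints (projectiveSpace (n + 1) ℂ)) :=
    ComplexPoints.compactSpace_of_isSmoothProjective (isSmoothProjective_projectiveSpace_holds ℂ (n + 1))
  exact bijective_complexBetti_map_of_isZariskiLocallyAffineProduct
    (isZariskiLocallyAffineProduct_of_mvPolynomial_charts (incidenceToProj ℂ n d M) (Nat.card M - 1)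
      (baseChart ℂ n) (exists_mem_baseChart ℂ n) (isAffineOpen_baseChart ℂ n)
      (isAffineOpen_incidenceToProj_preimage_baseChart ℂ n d M)
      (fun i => chartPolyEquiv ℂ n d M hM i hd) (fun i s => chartPolyEquiv_appLE ℂ n d M hM i hd s)) k

/-- **Monodromy invariants of a base-point-free monomial linear system come from `ℙⁿ⁺¹`** (parity-free
form, assuming `deligne_globalInvariantCycles`): for `M` base-point free, `n, d ≥ 1`, any `k` and
`t ∈ S_M(ℂ)`, the complexification of every `Γ_t`-invariant `x ∈ Hᵏ(Y_t; ℚ)` is the restriction of a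
class of `Hᵏ(ℙⁿ⁺¹(ℂ); ℂ)` along `Y_t ↪ 𝒴_M ↪ W_M → ℙⁿ⁺¹` (Voisin II Thm. 4.24 with `X ⊇ W_M`, and
`Hᵏ(W_M) ≅ Hᵏ(ℙⁿ⁺¹)`). For odd `k` this is `familyM_ratInvariant_eq_zero_of_odd`; for even `k = 2p`
it says the invariants are spanned by the restriction of `hᵖ`.
[cite: VoisinHodgeII2003, Thm. 4.24 and Cor. 4.25] [cite: DeligneHodgeII1971, Théorème 4.1.1] -/
theorem familyM_ofRatClass_ratInvariant_mem_range_projectiveSpace (hGIC : deligne_globalInvariantCycles)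
    {n d : ℕ} {M : Set (DegIndex n d)} (hM : IsBasePointFree n d M) (hn : 1 ≤ n) (hd : 1 ≤ d) (k : ℕ)
    (hU : IsCohomologicallyLocallyTrivialOn (familyM ℂ n d M) Set.univ)
    (t : ComplexPoints (baseM ℂ n d M))
    (x : bettiCohomology (fiberOver (familyM ℂ n d M) t) k)
    (hx : ∀ g ∈ ratMonodromyGroup (familyM ℂ n d M) k hU ⟨t, Set.mem_univ t⟩, g x = x) :
    ∃ η : complexBetti (projectiveSpace (n + 1) ℂ) k,
      ofRatClass _ k x = complexBetti.map
        (fiberι (familyM ℂ n d M) t ≫ totalMToIncidence ℂ n d M hd ≫ incidenceToProj ℂ n d M) k η := by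
  obtain ⟨β, hβ⟩ := familyM_ofRatClass_mem_range_of_factor hGIC hn hd k hU
    (smoothOfRelativeDimension_incidenceOverM_hom ℂ n d M hM hd)
    (isQuasiProjectiveOver_incidenceOverM ℂ n d M) (irreducibleSpace_incidenceM ℂ n d M hM hd)
    (totalMToIncidence ℂ n d M hd) (isOpenImmersion_totalMToIncidence_left ℂ n d M hd) t x hx
  obtain ⟨η, rfl⟩ := (bijective_complexBetti_map_incidenceToProj n d M hM hd k).2 β
  refine ⟨η, ?_⟩
  rw [hβ, ← Category.assoc, complexBetti.map_comp _ (incidenceToProj ℂ n d M), ModuleCat.comp_apply]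

end Literature.AlgebraicGeometry.HodgeTheory.UniversalHypersurface

end
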